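import Literature.NumberTheory.GaloisRepresentations.HeckeLFunctionNonvanishingProofs
import Literature.NumberTheory.GaloisRepresentations.HeckeCharacterNormTwistProofs
import Literature.NumberTheory.GaloisRepresentations.HeckeCharacterNormCharacter
import HarnessLib

/-!
# Non-vanishing of Hecke `L`-functions on the line `Re s = 1`, by twisting with `‖·‖^{it}`

Topic `NumberTheory/GaloisRepresentations`; namespace
`Literature.NumberTheory.GaloisRepresentations`. Proof file (theorems only: no definition, no
named fact, no instance, no `sorry`), sequel of `HeckeLFunctionNonvanishingProofs` (Hecke–Landau
at `s = 1`: `HeckeCharacter.continuation_apply_one_ne_zero_of_differentiable`).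

**Theorem (Hecke 1920; Iwasawa, *Hecke's `L`-functions* (Princeton lectures 1964), Ch. 4 §4.2,
Prop. 4.4, PDF p. 72 of the held copy `book:iwasawa2019-hecke-s-l-functions-spring-1964-with`).**
*"For any real `y`, `L(1 + iy; χ) ≠ 0`"* (for a Hecke character `χ ≢ 1` of `F`, `L(s; χ)` being
entire by Thm. 3.1).

Here in continuation-agnostic form (`HeckeCharacter.continuation_apply_ne_zero_of_re_eq_one`):
*if `χ` is unitary and `L(s, χ)`, `L(s, χ⁻¹)` extend to entire functions `g`, `g'`, then
`g(s₀) ≠ 0` for every `s₀` with `Re s₀ = 1`.* The printed proof is the Hadamard–de la Vallée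
Poussin inequality (Iwasawa's Lemma 4.3); the formal proof reduces the point `1 + it` to the point
`1` for the **twisted character** `χ ‖·‖^{it}` (Iwasawa (1964), §1, PDF p. 25: the characters of
`J/F^*` are the `χ |·|^{s}`; Tate (1950), §4.3: `c = c̃ |·|^s`), whose `L`-function is the
translate `L(s, χ ‖·‖^{it}) = L(s + it, χ)`, and applies the theorem at `s = 1`:

* `HeckeCharacter.exists_forall_apply_eq_ideleNorm_cpow` — for every `z ∈ ℂ` there is a Hecke
  character `ν = ‖·‖^z` of `K` (`ν(x) = ‖x‖^z`): the idelic norm is a continuous homomorphism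
  `𝕀_K → ℝ_{>0}` trivial on `Kˣ` (`Automorphic.continuous_ideleNorm_holds`, product formula
  `Automorphic.ideleNorm_principal`), and `r ↦ r^z` is a continuous homomorphism `ℝ_{>0} → ℂˣ`;
* for any `ν` with `ν(x) = ‖x‖^z`: `ν` is unramified everywhere
  (`IsNormTwist.isUnramifiedAt_holds`), `ν(ϖ_v) = N(v)^{-z}`
  (`valueAtUniformizer_of_forall_apply_eq_cpow`: `‖ϖ_v‖_v = N(v)⁻¹`), `|ν(x)| = ‖x‖^{Re z}`, so
  `ν` is unitary when `Re z = 0`, and `ν⁻¹ = ‖·‖^{-z}`;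
* `heckeLFunction_mul_eq_of_forall_apply_eq_cpow` — **`L(s, χ ν) = L(s + z, χ)`** for all `s`
  (an identity of Euler products: `χν` is unramified exactly where `χ` is, and
  `(χν)(ϖ_v) N(v)^{-s} = χ(ϖ_v) N(v)^{-(s+z)}`);
* `HeckeCharacter.continuation_apply_ne_zero_of_re_eq_one` (**main**) and its form over the
  tree's predicate `LFunction.HasEntireContinuation`.

## References

* K. Iwasawa, *Hecke's `L`-functions* (lectures, Princeton, Spring 1964), SpringerBriefs in
  Mathematics (2019): PDF p. 25, Thm. 3.1 (p. 58), Lemma 4.3 and Prop. 4.4 (pp. 71–73).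
  [Iwasawa2019]
* J. Tate, *Fourier analysis in number fields and Hecke's zeta-functions*, in Cassels–Fröhlich,
  *Algebraic Number Theory* (1967), Ch. XV, §2.3 (Lemma 2.3.1), §4.3, Thm. 4.4.1. [TateThesis1967]
* E. Hecke, *Eine neue Art von Zetafunktionen und ihre Beziehungen zur Verteilung der
  Primzahlen (Zweite Mitteilung)*, Math. Z. 6 (1920), 11–51. [HeckeMathZ1920]
-/

noncomputable section

open NumberField IsDedekindDomain Filter Complex Set
open scoped Topology ComplexConjugate NNReal

namespace Literature.NumberTheory.GaloisRepresentations

namespace HeckeCharacter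

/-! ### The norm-power characters `‖·‖^z` -/

section NormPow

variable (K : Type) [Field K] [NumberField K]

/-- The idelic norm (the tree's real-valued `ideleNorm`) is positive. [folklore] -/
theorem ideleNorm_pos' (x : ideleGroup K) : 0 < ideleNorm x := by
  rw [← Automorphic.coe_ideleNorm]
  exact NNReal.coe_pos.mpr (pos_iff_ne_zero.mpr (Automorphic.ideleNorm_ne_zero x))

/-- **The Hecke characters `‖·‖^z`.** For every `z ∈ ℂ` there is a Hecke character `ν` of `K`
with `ν(x) = ‖x‖^z` for all ideles `x`: the idelic norm `‖·‖ : 𝕀_K → ℝ_{>0}` is a continuous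
homomorphism (`Automorphic.continuous_ideleNorm_holds`, Weil IV §4) trivial on `Kˣ` (product
formula, `Automorphic.ideleNorm_principal`), and `r ↦ r^z = e^{z log r}` is a continuous
homomorphism `ℝ_{>0} → ℂˣ`. These are the quasi-characters `|𝔞|^s` of Tate (1950), §4.3 (the
ones trivial on `𝕀_K¹`), `IsNormTwist` in the tree. [cite: TateThesis1967, §4.3] -/
theorem exists_forall_apply_eq_ideleNorm_cpow (z : ℂ) :
    ∃ ν : HeckeCharacter K, ∀ x : ideleGroup K, ((ν x : ℂˣ) : ℂ) = ((ideleNorm x : ℝ) : ℂ) ^ z := by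
  set f : ideleGroup K → ℂ := fun x => ((ideleNorm x : ℝ) : ℂ) ^ z with hf
  have hf0 : ∀ x, f x ≠ 0 := fun x h => by
    rw [hf, Complex.cpow_eq_zero_iff] at h
    exact (Complex.ofReal_ne_zero.mpr (ideleNorm_pos' K x).ne') h.1
  have hf1 : f 1 = 1 := by
    simp only [hf]
    rw [← Automorphic.coe_ideleNorm, map_one, NNReal.coe_one, Complex.ofReal_one, Complex.one_cpow]
  have hfmul : ∀ x y, f (x * y) = f x * f y := fun x y => by
    simp only [hf]
    rw [← Automorphic.coe_ideleNorm, ← Automorphic.coe_ideleNorm, ← Automorphic.coe_ideleNorm,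
      map_mul, NNReal.coe_mul, Complex.ofReal_mul,
      Complex.mul_cpow_ofReal_nonneg (NNReal.coe_nonneg _) (NNReal.coe_nonneg _)]
  have hfc : Continuous f := by
    have hb : Continuous fun x : ideleGroup K => ((ideleNorm x : ℝ) : ℂ) := by
      have : (fun x : ideleGroup K => ((ideleNorm x : ℝ) : ℂ)) =
          fun x => (((Automorphic.IdeleClassGroup.ideleNorm K x : ℝ≥0) : ℝ) : ℂ) :=
        funext fun x => by rw [Automorphic.coe_ideleNorm]
      rw [this]
      exact Complex.continuous_ofReal.comp
        (NNReal.continuous_coe.comp (Automorphic.continuous_ideleNorm_holds K))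
    exact hb.cpow continuous_const fun x => Complex.ofReal_mem_slitPlane.mpr (ideleNorm_pos' K x)
  let φ : ideleGroup K →* ℂˣ :=
    { toFun := fun x => Units.mk0 (f x) (hf0 x)
      map_one' := Units.ext hf1
      map_mul' := fun x y => Units.ext (by simp only [Units.val_mk0, Units.val_mul, hfmul]) }
  have hφc : Continuous φ := by
    refine Units.continuous_iff.mpr ⟨hfc, ?_⟩
    refine (hfc.inv₀ hf0).congr fun x => ?_
    simp only [φ, MonoidHom.coe_mk, OneHom.coe_mk, Units.val_inv_eq_inv_val, Units.val_mk0,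
      Pi.inv_apply]
  refine ⟨{ toContinuousMonoidHom := { toMonoidHom := φ, continuous_toFun := hφc }
            map_principal' := fun x hx => Units.ext ?_ }, fun x => rfl⟩
  change f x = 1
  simp only [hf]
  rw [← Automorphic.coe_ideleNorm, Automorphic.ideleNorm_principal hx, NNReal.coe_one,
    Complex.ofReal_one, Complex.one_cpow]

variable {K}

/-- `‖ϖ_v‖_v = N(v)⁻¹` for the tree's uniformizer `ϖ_v` (Mathlib's norm on `K_v`,
`FinitePlace.norm_def`, base `absNorm v = N(v)`). [folklore] -/
theorem norm_uniformizer (v : HeightOneSpectrum (𝓞 K)) :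
    ‖(uniformizer K v : v.adicCompletion K)‖ = (((Ideal.absNorm v.asIdeal : ℕ) : ℝ))⁻¹ := by
  rw [NumberField.FinitePlace.norm_def, valued_uniformizer, WithZero.exp,
    WithZeroMulInt.toNNReal_neg_apply _ WithZero.coe_ne_zero, WithZero.unzero_coe, toAdd_ofAdd,
    zpow_neg, zpow_one, NNReal.coe_inv, NNReal.coe_natCast]

/-- **`‖·‖^z(ϖ_v) = N(v)^{-z}`**: the value at (the uniformizer of) `v` of a character `ν` with
`ν(x) = ‖x‖^z` is `‖ϖ_v‖_v^z = N(v)^{-z}` (`ideleNorm_localUnits`: the idele `(…, 1, ϖ_v, 1, …)`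
has norm `‖ϖ_v‖_v = N(v)⁻¹`). Ref: Tate (1950), §2.5 with §4.3 (`|π|^s = Np^{-s}`).
[cite: TateThesis1967, §4.3] -/
theorem valueAtUniformizer_of_forall_apply_eq_cpow {ν : HeckeCharacter K} {z : ℂ}
    (hν : ∀ x : ideleGroup K, ((ν x : ℂˣ) : ℂ) = ((ideleNorm x : ℝ) : ℂ) ^ z)
    (v : HeightOneSpectrum (𝓞 K)) :
    ν.valueAtUniformizer v = ((Ideal.absNorm v.asIdeal : ℕ) : ℂ) ^ (-z) := by
  rw [valueAtUniformizer, localComponent_apply, hν, ideleNorm_localUnits, norm_uniformizer,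
    Complex.ofReal_inv, Complex.ofReal_natCast,
    Complex.inv_cpow _ _ (by rw [Complex.natCast_arg]; exact Real.pi_ne_zero.symm),
    Complex.cpow_neg]

/-- `|‖x‖^z| = ‖x‖^{Re z}`. [folklore] -/
theorem norm_apply_of_forall_apply_eq_cpow {ν : HeckeCharacter K} {z : ℂ}
    (hν : ∀ x : ideleGroup K, ((ν x : ℂˣ) : ℂ) = ((ideleNorm x : ℝ) : ℂ) ^ z) (x : ideleGroup K) :
    ‖((ν x : ℂˣ) : ℂ)‖ = ideleNorm x ^ z.re := by
  rw [hν, Complex.norm_cpow_eq_rpow_re_of_pos (ideleNorm_pos' K x)]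

/-- `‖·‖^{it}` is unitary (`Re z = 0`). [folklore] -/
theorem isUnitary_of_forall_apply_eq_cpow {ν : HeckeCharacter K} {z : ℂ}
    (hν : ∀ x : ideleGroup K, ((ν x : ℂˣ) : ℂ) = ((ideleNorm x : ℝ) : ℂ) ^ z) (hz : z.re = 0) :
    ν.IsUnitary := fun x => by
  rw [norm_apply_of_forall_apply_eq_cpow hν, hz, Real.rpow_zero]

/-- `(‖·‖^z)⁻¹ = ‖·‖^{-z}`. [folklore] -/
theorem inv_apply_of_forall_apply_eq_cpow {ν : HeckeCharacter K} {z : ℂ}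
    (hν : ∀ x : ideleGroup K, ((ν x : ℂˣ) : ℂ) = ((ideleNorm x : ℝ) : ℂ) ^ z) (x : ideleGroup K) :
    ((ν⁻¹ x : ℂˣ) : ℂ) = ((ideleNorm x : ℝ) : ℂ) ^ (-z) := by
  rw [inv_apply, Units.val_inv_eq_inv_val, hν, Complex.cpow_neg]

/-- `(χ ψ)(ϖ_v) = χ(ϖ_v) ψ(ϖ_v)` (a copy of `HeckeCharacter.valueAtUniformizer_mul` of
`Automorphic/PairLFunctionPolesGLOneProofs`, not imported here). [folklore] -/
private theorem valueAtUniformizer_mul' (χ ψ : HeckeCharacter K) (v : HeightOneSpectrum (𝓞 K)) :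
    (χ * ψ).valueAtUniformizer v = χ.valueAtUniformizer v * ψ.valueAtUniformizer v := by
  simp only [valueAtUniformizer, localComponent_apply, mul_apply, Units.val_mul]

/-- A product of characters unramified at `v` is unramified at `v` (a copy of
`HeckeCharacter.IsUnramifiedAt.mul` of `Automorphic/PairLFunctionPolesGLOneProofs`). [folklore] -/
private theorem isUnramifiedAt_mul' {χ ψ : HeckeCharacter K} {v : HeightOneSpectrum (𝓞 K)}
    (hχ : χ.IsUnramifiedAt v) (hψ : ψ.IsUnramifiedAt v) : (χ * ψ).IsUnramifiedAt v := by
  intro u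
  have h1 := hχ u
  have h2 := hψ u
  rw [localComponent_apply] at h1 h2 ⊢
  rw [mul_apply, h1, h2, one_mul]

/-- `χ ‖·‖^z` is unramified at `v` iff `χ` is (`‖·‖^{±z}` is unramified everywhere,
`IsNormTwist.isUnramifiedAt_holds`). [folklore] -/
theorem isUnramifiedAt_mul_iff_of_forall_apply_eq_cpow (χ : HeckeCharacter K)
    {ν : HeckeCharacter K} {z : ℂ}
    (hν : ∀ x : ideleGroup K, ((ν x : ℂˣ) : ℂ) = ((ideleNorm x : ℝ) : ℂ) ^ z)
    (v : HeightOneSpectrum (𝓞 K)) : (χ * ν).IsUnramifiedAt v ↔ χ.IsUnramifiedAt v := by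
  have hνu : ν.IsUnramifiedAt v := IsNormTwist.isUnramifiedAt_holds ⟨z, hν⟩ v
  refine ⟨fun h => ?_, fun h => isUnramifiedAt_mul' h hνu⟩
  have h' := isUnramifiedAt_mul' h (isUnramifiedAt_inv_iff.mpr hνu)
  rwa [mul_inv_cancel_right] at h'

/-- **`L(s, χ ‖·‖^z) = L(s + z, χ)`** for all `s` (an identity of unconditional Euler products
over all places, `heckeLFunction_eq_tprod_ite`: `χν` is unramified exactly where `χ` is, and
`(χν)(ϖ_v) N(v)^{-s} = χ(ϖ_v) N(v)^{-z} N(v)^{-s} = χ(ϖ_v) N(v)^{-(s+z)}`). Ref: Iwasawa (1964),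
§3 (translation of `L`-functions by `|·|^s`); Tate (1950), §4.4 (`ζ(f, c|·|^s)`).
[cite: TateThesis1967, §4.4] -/
theorem heckeLFunction_mul_eq_of_forall_apply_eq_cpow (χ : HeckeCharacter K)
    {ν : HeckeCharacter K} {z : ℂ}
    (hν : ∀ x : ideleGroup K, ((ν x : ℂˣ) : ℂ) = ((ideleNorm x : ℝ) : ℂ) ^ z) (s : ℂ) :
    heckeLFunction (χ * ν) s = heckeLFunction χ (s + z) := by
  classical
  rw [heckeLFunction_eq_tprod_ite, heckeLFunction_eq_tprod_ite]
  refine tprod_congr fun v => ?_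
  have hq0 : ((Ideal.absNorm v.asIdeal : ℕ) : ℂ) ≠ 0 :=
    Nat.cast_ne_zero.mpr (LFunctions.absNorm_heightOneSpectrum_pos v).ne'
  by_cases hχu : χ.IsUnramifiedAt v
  · rw [if_pos ((isUnramifiedAt_mul_iff_of_forall_apply_eq_cpow χ hν v).mpr hχu), if_pos hχu,
      valueAtUniformizer_mul', valueAtUniformizer_of_forall_apply_eq_cpow hν, mul_assoc,
      ← Complex.cpow_add _ _ hq0, neg_add, add_comm]
  · rw [if_neg (fun h => hχu ((isUnramifiedAt_mul_iff_of_forall_apply_eq_cpow χ hν v).mp h)),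
      if_neg hχu, zero_mul, zero_mul]

end NormPow

/-! ### Hecke–Landau on the line `Re s = 1` -/

section Line

variable {K : Type} [Field K] [NumberField K]

/-- **Hecke–Landau on `Re s = 1`** (Iwasawa (1964), Prop. 4.4: "for any real `y`,
`L(1 + iy; χ) ≠ 0`"), continuation-agnostic form: if `χ` is unitary and `L(s, χ)`, `L(s, χ⁻¹)`
extend to entire functions `g`, `g'`, then `g(s₀) ≠ 0` whenever `Re s₀ = 1`. Proof: with
`t = Im s₀` and `ν = ‖·‖^{it}` (`exists_forall_apply_eq_ideleNorm_cpow`), the character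
`ψ = χ ν` is unitary with `L(s, ψ) = L(s + it, χ)` and `L(s, ψ⁻¹) = L(s - it, χ⁻¹)`
(`heckeLFunction_mul_eq_of_forall_apply_eq_cpow`), so `s ↦ g(s + it)`, `s ↦ g'(s - it)` are
entire continuations of `L(s, ψ^{±1})`, and `g(1 + it) ≠ 0` by the theorem at `s = 1`
(`continuation_apply_one_ne_zero_of_differentiable`, Landau's method). The printed proof is the
`3, 4, 1` inequality (Iwasawa's Lemma 4.3). [cite: Iwasawa2019, Ch. 4 §4.2 Prop. 4.4] -/
theorem continuation_apply_ne_zero_of_re_eq_one {χ : HeckeCharacter K} (hχ : χ.IsUnitary)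
    {g g' : ℂ → ℂ} (hg : Differentiable ℂ g)
    (hg_eq : ∀ s : ℂ, 1 < s.re → g s = heckeLFunction χ s) (hg' : Differentiable ℂ g')
    (hg'_eq : ∀ s : ℂ, 1 < s.re → g' s = heckeLFunction χ⁻¹ s) {s₀ : ℂ} (hs₀ : s₀.re = 1) :
    g s₀ ≠ 0 := by
  set t : ℝ := s₀.im with ht
  obtain ⟨ν, hν⟩ := exists_forall_apply_eq_ideleNorm_cpow K (I * t)
  have hνu : ν.IsUnitary := isUnitary_of_forall_apply_eq_cpow hν (by simp)
  have hν' : ∀ x : ideleGroup K, ((ν⁻¹ x : ℂˣ) : ℂ) = ((ideleNorm x : ℝ) : ℂ) ^ (-(I * t)) :=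
    inv_apply_of_forall_apply_eq_cpow hν
  have hs₀' : s₀ = 1 + I * t := Complex.ext (by simp [hs₀]) (by simp [ht])
  -- the translated continuations
  have h1 : g (1 + I * t) ≠ 0 := by
    refine continuation_apply_one_ne_zero_of_differentiable (χ := χ * ν) (hχ.mul hνu)
      (g := fun s => g (s + I * t)) (g' := fun s => g' (s - I * t))
      (hg.comp (differentiable_id.add_const _)) (fun s hs => ?_)
      (hg'.comp (differentiable_id.sub_const _)) (fun s hs => ?_)
    · have hs' : 1 < (s + I * t).re := by simpa using hs
      rw [hg_eq _ hs', heckeLFunction_mul_eq_of_forall_apply_eq_cpow χ hν s]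
    · have hs' : 1 < (s - I * t).re := by simpa using hs
      rw [hg'_eq _ hs', mul_inv, heckeLFunction_mul_eq_of_forall_apply_eq_cpow χ⁻¹ hν' s,
        sub_eq_add_neg]
  rwa [hs₀']

/-- **Hecke–Landau on `Re s = 1` for the tree's continuation predicate.** If `L(s, χ)` and
`L(s, χ⁻¹)` (`χ` unitary) have entire continuations (`LFunction.HasEntireContinuation`, as
provided by the named fact `heckeLFunction_hasEntireContinuation_of_not_isNormTwist` for `χ` not
a norm twist), then the entire continuation of `L(s, χ)` has no zero on the line `Re s = 1`.
[cite: Iwasawa2019, Ch. 4 §4.2 Prop. 4.4] -/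
theorem hasEntireContinuation_continuation_ne_zero_of_re_eq_one {χ : HeckeCharacter K}
    (hχ : χ.IsUnitary) (h : LFunction.HasEntireContinuation (heckeLFunction χ))
    (h' : LFunction.HasEntireContinuation (heckeLFunction χ⁻¹)) {s₀ : ℂ} (hs₀ : s₀.re = 1) :
    h.continuation s₀ ≠ 0 :=
  continuation_apply_ne_zero_of_re_eq_one hχ h.differentiable_continuation
    (fun _ hs => h.continuation_eq hs) h'.differentiable_continuation
    (fun _ hs => h'.continuation_eq hs) hs₀

end Line

end HeckeCharacter

end Literature.NumberTheory.GaloisRepresentations
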